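import Summits.BirchSwinnertonDyer.Rank1Residual.AdditivePotMult.OneSided
import Literature.NumberTheory.EllipticCurves.ModifiedTamagawaProduct
import HarnessLib

/-!
# X3♯(M) / X4(M): the over-`K` input MODEL-FREE (Dokchitser–Dokchitser's `C(E/K) = ∏ c_v |ω/ω_v°|_v`)
# — no globally minimal `K`-model, no "prime above `p` principal" condition

HONEST FRAMING (cell `b2b-bsdres`, run/shared/lean/b2b/bsd-rank1-residual/, verbatim in every
file): the goal of the cell is to DELETE the COMBINATION-SHAPED residual classes of the
Birch–Swinnerton-Dyer formula for ALL analytic-rank `≤ 1` elliptic curves over `ℚ` — "full BSD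
formula for every rank `≤ 1` curve in class `C`" assembled STRICTLY from published theorems — so
that the rank-`≤ 1` remainder becomes exactly the CONSTRUCTION-SHAPED classes, which are TYPED
(missing-input `Prop`s), NOT attempted. This is not "finishing BSD". Sub-cell
`b2b-bsdres-additive-p1` (CLASS-OWNERS row "X3/X4 additive — pot. multiplicative / X3♯(M)"),
generation 2; research route, no claim beyond the stated sub-classes; X3♯(M), X4(M) REMAIN
CONSTRUCTION-SHAPED.

Why this file. `Descent.lean` types the relocated missing input `MissingPPartOverAt W' p` on a
GLOBALLY MINIMAL `K`-model `W'` of `E_K` (so that the BSD period of `W'` and the plain Tamagawa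
product are the BSD quantities). For `K = ℚ(√D)` ramified at `p` the base-changed ℤ-minimal model
`W ⊗ K` is minimal at every prime of `K` except the prime `𝔭` above `p` (type `I_n^*` becomes
`I_{2n}` after one `π`-scaling), so a globally minimal `K`-model exists iff the class of `𝔭` in
`Cl(K)` is trivial — automatic for `K = ℚ(√p*)`, a class-group accident otherwise (gen-0 census:
256 of the 1754 X4(M) pairs `N < 2·10⁴` have a twist witness failing ONLY this). The accident is an
artefact of the vocabulary, not of the mathematics: Dokchitser–Dokchitser (Ann. of Math. 172 (2010)
§1 Notation, §2.1) state the Birch–Swinnerton-Dyer quotient for an ARBITRARY differential `ω`, with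
the modified Tamagawa product `C(E/K) = ∏_{v∤∞} c_v |ω/ω_v°|_v` compensating the period — and the
tree DEFINES that `C` verbatim (`WeierstrassCurve.modifiedTamagawaProduct`, `ModifiedTamagawaProduct.lean`).
This file re-types the over-`K` input on ANY `K`-model `V` of `E_K` (canonically `V = W.baseChange K`)
in that currency and re-proves the descent bookkeeping for it; the Weil-restriction identity in the
same currency is the Literature named fact `Milne1972.bsdQuotient_baseChange_quadratic_anyModel`
(`WeilRestrictionQuadraticBSDQuotientAnyModel.lean`; in §2 it enters as the explicit hypothesis
`hWR`, exactly as in `Descent.lean`; `ModelFreeClassTheorems.lean` discharges it).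

* `shaAnOverC V` — `#Ш_an(E_K/K)` computed on the model `V` with differential `ω_V`:
  `L^*(V,1)·#V(K)_tors² / (Ω(ω_V)·C(E_K/K, ω_V)·Reg)`; independent of `V` (product formula; not
  needed, not proved);
* `MissingPPartOverCAt V p`, `MissingLowerBoundOverCAt V p`, `MissingUpperBoundOverCAt V p` — the
  typed over-`K` input and its two halves on `V`; predicates, nothing asserted;
* `shaAnOverC_mul_eq` — (★) `#Ш_an(V)·#Ш(W)·#Ш(Wd) = #Ш_an(W)·#Ш_an(Wd)·#Ш(V)` from `hWR` + Artin
  formalism (as `shaAnOver_mul_eq`);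
* `bsdp_of_pPartOverC_of_bsdp_twist` — DESCENT, any `p`: `MissingPPartOverCAt V p → BSDp Wd p → BSDp W p`;
* `padicValRat_defectC_eq` — the `p`-adic BSD defect `ord_p #Ш_an − ord_p #Ш` agrees on `V/K` and
  `W/ℚ` given `BSD(Wd,p)` (any `p`); `missingPPartOverCAt_iff_bsdp`, `missingLowerBoundAt_iff_overC`,
  `missingUpperBoundAt_iff_overC` — whole and halves relocate exactly.

The class theorems on the CANONICAL model `V = W.baseChange K`, with `hWR` discharged from the
named fact, are in `ModelFreeClassTheorems.lean`.

Located gap unchanged (module docstring of `ClassTheorems.lean`; gen-2 addendum in `OneSided.lean`).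
-/

noncomputable section

open scoped Classical

open WeierstrassCurve Literature.NumberTheory.EllipticCurves
  Literature.NumberTheory.EllipticCurves.Rank1Residual
  Literature.NumberTheory.EllipticCurves.Rank1Residual.Typed

namespace Summit.BirchSwinnertonDyer.Rank1Residual.AdditivePotMult

/-! ## §1 The over-`K` quantities on an arbitrary model -/

section OverK

variable {K : Type*} [Field K] [NumberField K]

/-- **`#Ш_an(E/K)` on an arbitrary `K`-model `V`**, Dokchitser–Dokchitser's normalisation:
`L^{(r)}(E_K,1)/r! · #E(K)_tors² / (Ω(E_K/K, ω_V) · C(E_K/K, ω_V) · Reg(E_K/K))` with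
`Ω(·, ω_V) = V.bsdPeriod` (the archimedean integrals of `ω_V` over `|d_K|^{1/2}`) and
`C(·, ω_V) = V.modifiedTamagawaProduct = ∏_v c_v |ω_V/ω_v°|_v` (the tree's verbatim definition of
D–D 2010 §1 Notation). For a globally minimal `V` this is `shaAnOver V` of `Descent.lean`
(all `|ω_V/ω_v°|_v = 1`; not needed here). A complex number. [folklore] -/
def shaAnOverC (V : WeierstrassCurve K) : ℂ :=
  V.leadingLCoeff * (V.torsionOrder : ℂ) ^ 2 /
    ((V.bsdPeriod : ℂ) * (V.modifiedTamagawaProduct : ℂ) * (V.regulator : ℂ))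

/-- **The typed over-`K` input on the model `V`** (model-free form of `MissingPPartOverAt`): the
`p`-part of the Birch–Swinnerton-Dyer formula for `E_K` over `K` in Miller's currency —
"`#Ш_an(V/K)` is a rational `q` with `ord_p q = ord_p #Ш(V/K)`". In the route `V = W.baseChange K`,
`K = ℚ(√D)` ramified at `p`, `E_K` multiplicative at the prime above `p`; printed nowhere (the
located gap, `ClassTheorems.lean`). A predicate; NOTHING asserted. [folklore] -/
def MissingPPartOverCAt (V : WeierstrassCurve K) (p : ℕ) : Prop :=
  ∃ q : ℚ, shaAnOverC V = (q : ℂ) ∧ padicValRat p q = padicValNat p V.shaOrder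

/-- Lower half on the model `V` ("main-conjecture" direction): `ord_p #Ш_an(V/K) ≤ ord_p #Ш(V/K)`.
A predicate; nothing asserted. [folklore] -/
def MissingLowerBoundOverCAt (V : WeierstrassCurve K) (p : ℕ) : Prop :=
  ∃ q : ℚ, shaAnOverC V = (q : ℂ) ∧ padicValRat p q ≤ padicValNat p V.shaOrder

/-- Upper half on the model `V` ("Euler-system" direction): `ord_p #Ш(V/K) ≤ ord_p #Ш_an(V/K)`.
A predicate; nothing asserted. [folklore] -/
def MissingUpperBoundOverCAt (V : WeierstrassCurve K) (p : ℕ) : Prop :=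
  ∃ q : ℚ, shaAnOverC V = (q : ℂ) ∧ (padicValNat p V.shaOrder : ℤ) ≤ padicValRat p q

/-- Halves make the whole on `V`. [folklore] -/
theorem missingPPartOverCAt_of_lower_of_upper (V : WeierstrassCurve K) (p : ℕ)
    (hl : MissingLowerBoundOverCAt V p) (hu : MissingUpperBoundOverCAt V p) :
    MissingPPartOverCAt V p := by
  obtain ⟨q, hq, hle⟩ := hl
  obtain ⟨q', hq', hge⟩ := hu
  have hqq : q' = q := by exact_mod_cast hq'.symm.trans hq
  subst hqq
  exact ⟨q', hq, le_antisymm hle hge⟩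

/-- The whole gives both halves on `V`. [folklore] -/
theorem lower_and_upper_of_missingPPartOverCAt (V : WeierstrassCurve K) (p : ℕ)
    (h : MissingPPartOverCAt V p) :
    MissingLowerBoundOverCAt V p ∧ MissingUpperBoundOverCAt V p := by
  obtain ⟨q, hq, hv⟩ := h
  exact ⟨⟨q, hq, hv.le⟩, ⟨q, hq, hv.ge⟩⟩

end OverK

/-! ## §2 The identity (★) on an arbitrary model and the descent theorem -/

section Descent

variable (W : WeierstrassCurve ℚ) [W.IsElliptic] (p : ℕ) [Fact p.Prime]
  (K : Type) [Field K] [NumberField K]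
  (Wd : WeierstrassCurve ℚ) [Wd.IsElliptic] (V : WeierstrassCurve K) [V.IsElliptic]

omit [Fact p.Prime] in
/-- **(★) on the model `V`**: with the model-free Weil-restriction identity `hWR`
(`#Ш(V)·Reg(V)·Ω(ω_V)·C(V)/#tors(V)² = RHS(W)·RHS(Wd)`, Literature fact
`Milne1972.bsdQuotient_baseChange_quadratic_anyModel`) and Artin formalism (`leadingLCoeff_models_eq`):
`#Ш_an(V)·#Ш(W)·#Ш(Wd) = #Ш_an(W)·#Ш_an(Wd)·#Ш(V)` in `ℂ` (`Ш(W)`, `Ш(Wd)` finite). Same algebra as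
`shaAnOver_mul_eq`. [folklore] -/
theorem shaAnOverC_mul_eq (hmod : hasEntireLFunction_rat) (h2 : Module.finrank ℚ K = 2)
    (hWd : ∃ C : VariableChange ℚ, C • W.quadraticTwist (NumberField.discr K : ℚ) = Wd)
    (hV : ∃ C : VariableChange K, C • W.baseChange K = V)
    (hshaW : W.ShaFinite) (hshaD : Wd.ShaFinite)
    (hWR : (V.shaOrder : ℝ) * V.regulator * V.bsdPeriod * (V.modifiedTamagawaProduct : ℝ) /
        (V.torsionOrder : ℝ) ^ 2 = W.bsdRHS * Wd.bsdRHS) :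
    shaAnOverC V * (W.shaOrder : ℂ) * (Wd.shaOrder : ℂ) =
      shaAn W * shaAn Wd * (V.shaOrder : ℂ) := by
  -- positivity over `ℚ`
  have hBW : 0 < W.bsdRHS := W.bsdRHS_pos' hshaW
  have hBD : 0 < Wd.bsdRHS := Wd.bsdRHS_pos' hshaD
  have hB : 0 < W.bsdRHS * Wd.bsdRHS := mul_pos hBW hBD
  have hRW : (0 : ℝ) < W.regulator := W.regulator_pos'
  have hRD : (0 : ℝ) < Wd.regulator := Wd.regulator_pos'
  have hΩW : (0 : ℝ) < W.realPeriodRat := W.realPeriodRat_pos_holds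
  have hΩD : (0 : ℝ) < Wd.realPeriodRat := Wd.realPeriodRat_pos_holds
  have hcW : (0 : ℝ) < W.tamagawaProduct := Nat.cast_pos.mpr W.tamagawaProduct_pos_holds
  have hcD : (0 : ℝ) < Wd.tamagawaProduct := Nat.cast_pos.mpr Wd.tamagawaProduct_pos_holds
  have htW : (0 : ℝ) < W.torsionOrder := Nat.cast_pos.mpr W.torsionOrder_pos_holds
  have htD : (0 : ℝ) < Wd.torsionOrder := Nat.cast_pos.mpr Wd.torsionOrder_pos_holds
  -- non-vanishing over `K`, read off the identity
  have htK : (V.torsionOrder : ℝ) ≠ 0 := by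
    intro h0
    rw [h0, zero_pow two_ne_zero, div_zero] at hWR
    exact hB.ne hWR
  have hRK : V.regulator ≠ 0 := by
    intro h0
    rw [h0, mul_zero, zero_mul, zero_mul, zero_div] at hWR
    exact hB.ne hWR
  have hΩK : V.bsdPeriod ≠ 0 := by
    intro h0
    rw [h0, mul_zero, zero_mul, zero_div] at hWR
    exact hB.ne hWR
  have hcK : (V.modifiedTamagawaProduct : ℝ) ≠ 0 := by
    intro h0
    rw [h0, mul_zero, zero_div] at hWR
    exact hB.ne hWR
  -- pass to `ℂ`
  have hL := leadingLCoeff_models_eq W K Wd V hmod h2 hWd hV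
  have hWR' : ((V.shaOrder : ℝ) : ℂ) * (V.regulator : ℂ) * (V.bsdPeriod : ℂ) *
      ((V.modifiedTamagawaProduct : ℝ) : ℂ) / ((V.torsionOrder : ℝ) : ℂ) ^ 2 =
      (W.bsdRHS : ℂ) * (Wd.bsdRHS : ℂ) := by
    exact_mod_cast congrArg (fun x : ℝ => (x : ℂ)) hWR
  rw [shaAnOverC, shaAn_def, shaAn_def, hL]
  rw [bsdRHS_def, bsdRHS_def] at hWR'
  have htK' : (V.torsionOrder : ℂ) ≠ 0 := by exact_mod_cast htK
  have hRK' : (V.regulator : ℂ) ≠ 0 := by exact_mod_cast hRK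
  have hΩK' : (V.bsdPeriod : ℂ) ≠ 0 := by exact_mod_cast hΩK
  have hcK' : (V.modifiedTamagawaProduct : ℂ) ≠ 0 := by exact_mod_cast hcK
  have hRW' : (W.regulator : ℂ) ≠ 0 := by exact_mod_cast hRW.ne'
  have hRD' : (Wd.regulator : ℂ) ≠ 0 := by exact_mod_cast hRD.ne'
  have hΩW' : (W.realPeriodRat : ℂ) ≠ 0 := by exact_mod_cast hΩW.ne'
  have hΩD' : (Wd.realPeriodRat : ℂ) ≠ 0 := by exact_mod_cast hΩD.ne'
  have hcW' : (W.tamagawaProduct : ℂ) ≠ 0 := by exact_mod_cast hcW.ne'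
  have hcD' : (Wd.tamagawaProduct : ℂ) ≠ 0 := by exact_mod_cast hcD.ne'
  have htW' : (W.torsionOrder : ℂ) ≠ 0 := by exact_mod_cast htW.ne'
  have htD' : (Wd.torsionOrder : ℂ) ≠ 0 := by exact_mod_cast htD.ne'
  push_cast at hWR' ⊢
  field_simp
  field_simp at hWR'
  linear_combination (-(W.leadingLCoeff * Wd.leadingLCoeff)) * hWR'

/-- Rationality transfers down on `V`: `#Ш_an(W) = q'·#Ш(W)·#Ш(Wd)/(q_d·#Ш(V))`. [folklore] -/
theorem exists_shaAn_eq_of_overC (hmod : hasEntireLFunction_rat) (h2 : Module.finrank ℚ K = 2)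
    (hWd : ∃ C : VariableChange ℚ, C • W.quadraticTwist (NumberField.discr K : ℚ) = Wd)
    (hV : ∃ C : VariableChange K, C • W.baseChange K = V)
    (hshaW : W.ShaFinite) (hshaD : Wd.ShaFinite) (hshaK : V.ShaFinite)
    (hWR : (V.shaOrder : ℝ) * V.regulator * V.bsdPeriod * (V.modifiedTamagawaProduct : ℝ) /
        (V.torsionOrder : ℝ) ^ 2 = W.bsdRHS * Wd.bsdRHS)
    {q' qd : ℚ} (hq' : shaAnOverC V = (q' : ℂ)) (hqd : shaAn Wd = (qd : ℂ)) :
    shaAn W = ((q' * W.shaOrder * Wd.shaOrder / (qd * V.shaOrder) : ℚ) : ℂ) := by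
  have hstar := shaAnOverC_mul_eq W K Wd V hmod h2 hWd hV hshaW hshaD hWR
  have hsK : V.shaOrder ≠ 0 := (V.shaOrder_pos hshaK).ne'
  have hqd0 : (qd : ℂ) ≠ 0 := by rw [← hqd]; exact shaAn_ne_zero Wd hmod
  have hden : (qd : ℂ) * (V.shaOrder : ℂ) ≠ 0 := mul_ne_zero hqd0 (by exact_mod_cast hsK)
  push_cast
  rw [eq_div_iff hden, ← hqd, ← hq']
  linear_combination -hstar

/-- Rationality transfers up on `V`: `#Ш_an(V) = q·q_d·#Ш(V)/(#Ш(W)·#Ш(Wd))`. [folklore] -/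
theorem exists_shaAnOverC_eq_of_rat (hmod : hasEntireLFunction_rat) (h2 : Module.finrank ℚ K = 2)
    (hWd : ∃ C : VariableChange ℚ, C • W.quadraticTwist (NumberField.discr K : ℚ) = Wd)
    (hV : ∃ C : VariableChange K, C • W.baseChange K = V)
    (hshaW : W.ShaFinite) (hshaD : Wd.ShaFinite)
    (hWR : (V.shaOrder : ℝ) * V.regulator * V.bsdPeriod * (V.modifiedTamagawaProduct : ℝ) /
        (V.torsionOrder : ℝ) ^ 2 = W.bsdRHS * Wd.bsdRHS)
    {q qd : ℚ} (hq : shaAn W = (q : ℂ)) (hqd : shaAn Wd = (qd : ℂ)) :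
    shaAnOverC V = ((q * qd * V.shaOrder / (W.shaOrder * Wd.shaOrder) : ℚ) : ℂ) := by
  have hstar := shaAnOverC_mul_eq W K Wd V hmod h2 hWd hV hshaW hshaD hWR
  have hsW : W.shaOrder ≠ 0 := (W.shaOrder_pos hshaW).ne'
  have hsD : Wd.shaOrder ≠ 0 := (Wd.shaOrder_pos hshaD).ne'
  have hden : (W.shaOrder : ℂ) * (Wd.shaOrder : ℂ) ≠ 0 :=
    mul_ne_zero (by exact_mod_cast hsW) (by exact_mod_cast hsD)
  push_cast
  rw [eq_div_iff hden, ← hq, ← hqd]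
  linear_combination hstar

/-- **The `p`-adic BSD defect on `V/K` equals that on `W/ℚ`** (any `p`), given `hWR`, finiteness
and `BSD(Wd,p)`: `ord_p q' − ord_p #Ш(V) = ord_p q − ord_p #Ш(W)` for rational values
`#Ш_an(W) = q`, `#Ш_an(V) = q'`. [folklore] -/
theorem padicValRat_defectC_eq (hmod : hasEntireLFunction_rat) (h2 : Module.finrank ℚ K = 2)
    (hWd : ∃ C : VariableChange ℚ, C • W.quadraticTwist (NumberField.discr K : ℚ) = Wd)
    (hV : ∃ C : VariableChange K, C • W.baseChange K = V)
    (hshaW : W.ShaFinite) (hshaD : Wd.ShaFinite) (hshaK : V.ShaFinite)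
    (hWR : (V.shaOrder : ℝ) * V.regulator * V.bsdPeriod * (V.modifiedTamagawaProduct : ℝ) /
        (V.torsionOrder : ℝ) ^ 2 = W.bsdRHS * Wd.bsdRHS)
    (hd : BSDp Wd p) {q q' : ℚ} (hq : shaAn W = (q : ℂ)) (hq' : shaAnOverC V = (q' : ℂ)) :
    padicValRat p q' - padicValNat p V.shaOrder = padicValRat p q - padicValNat p W.shaOrder := by
  haveI : Finite Wd.sha := hshaD
  obtain ⟨qd, hqd, hvd⟩ := missingPPartAt_of_bsdp Wd p hd
  have hstar := shaAnOverC_mul_eq W K Wd V hmod h2 hWd hV hshaW hshaD hWR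
  have hsW : W.shaOrder ≠ 0 := (W.shaOrder_pos hshaW).ne'
  have hsD : Wd.shaOrder ≠ 0 := (Wd.shaOrder_pos hshaD).ne'
  have hsK : V.shaOrder ≠ 0 := (V.shaOrder_pos hshaK).ne'
  have hq0 : q ≠ 0 := by
    intro h0; apply shaAn_ne_zero W hmod; rw [hq, h0, Rat.cast_zero]
  have hqd0 : qd ≠ 0 := by
    intro h0; apply shaAn_ne_zero Wd hmod; rw [hqd, h0, Rat.cast_zero]
  have hQ : q' * W.shaOrder * Wd.shaOrder = q * qd * V.shaOrder := by
    have h : ((q' * W.shaOrder * Wd.shaOrder : ℚ) : ℂ) = ((q * qd * V.shaOrder : ℚ) : ℂ) := by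
      push_cast
      rw [← hq, ← hq', ← hqd]
      exact hstar
    exact_mod_cast h
  have hsKq : (V.shaOrder : ℚ) ≠ 0 := by exact_mod_cast hsK
  have hq'0 : q' ≠ 0 := by
    intro h0
    rw [h0, zero_mul, zero_mul] at hQ
    exact mul_ne_zero (mul_ne_zero hq0 hqd0) hsKq hQ.symm
  have hsWq : (W.shaOrder : ℚ) ≠ 0 := by exact_mod_cast hsW
  have hsDq : (Wd.shaOrder : ℚ) ≠ 0 := by exact_mod_cast hsD
  have hv := congrArg (padicValRat p) hQ
  rw [padicValRat.mul (mul_ne_zero hq'0 hsWq) hsDq, padicValRat.mul hq'0 hsWq,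
    padicValRat.mul (mul_ne_zero hq0 hqd0) hsKq, padicValRat.mul hq0 hqd0, hvd,
    padicValRat.of_nat, padicValRat.of_nat, padicValRat.of_nat] at hv
  push_cast at hv ⊢
  linarith

/-- **DESCENT THEOREM, model-free (any prime `p`).** `W/ℚ` of analytic rank `≤ 1`, `K` quadratic,
`Wd` a model of `W^{(d_K)}` of analytic rank `≤ 1` with `BSD(Wd,p)`, `V` ANY `K`-model of `W_K` with
`Ш(V)` finite and the model-free Weil-restriction identity `hWR`: then
`MissingPPartOverCAt V p → BSDp W p`. (Gross–Zagier–Kolyvagin `hGZK`, modularity `hmod`.) [folklore] -/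
theorem bsdp_of_pPartOverC_of_bsdp_twist
    (hGZK : rank_eq_analyticRank_of_analyticRank_le_one) (hmod : hasEntireLFunction_rat)
    (hr : W.analyticRank ≤ 1) (h2 : Module.finrank ℚ K = 2)
    (hWd : ∃ C : VariableChange ℚ, C • W.quadraticTwist (NumberField.discr K : ℚ) = Wd)
    (hrd : Wd.analyticRank ≤ 1)
    (hV : ∃ C : VariableChange K, C • W.baseChange K = V) (hshaK : V.ShaFinite)
    (hWR : (V.shaOrder : ℝ) * V.regulator * V.bsdPeriod * (V.modifiedTamagawaProduct : ℝ) /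
        (V.torsionOrder : ℝ) ^ 2 = W.bsdRHS * Wd.bsdRHS)
    (hK : MissingPPartOverCAt V p) (hd : BSDp Wd p) : BSDp W p := by
  obtain ⟨-, hfinW⟩ := hGZK W hr
  obtain ⟨-, hfinD⟩ := hGZK Wd hrd
  haveI : Finite Wd.sha := hfinD
  obtain ⟨qd, hqd, -⟩ := missingPPartAt_of_bsdp Wd p hd
  obtain ⟨q', hq', hv'⟩ := hK
  have hq := exists_shaAn_eq_of_overC W K Wd V hmod h2 hWd hV hfinW hfinD hshaK hWR hq' hqd
  refine bsdp_of_missingPPartAt W p hGZK hr ⟨_, hq, ?_⟩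
  have hdef := padicValRat_defectC_eq W p K Wd V hmod h2 hWd hV hfinW hfinD hshaK hWR hd hq hq'
  linarith

/-- **The model-free over-`K` input is necessary as well as sufficient** (any `p`): given `hWR`,
finiteness and `BSD(Wd,p)`, `MissingPPartOverCAt V p ↔ BSDp W p` for `W` of analytic rank `≤ 1`.
[folklore] -/
theorem missingPPartOverCAt_iff_bsdp
    (hGZK : rank_eq_analyticRank_of_analyticRank_le_one) (hmod : hasEntireLFunction_rat)
    (hr : W.analyticRank ≤ 1) (h2 : Module.finrank ℚ K = 2)
    (hWd : ∃ C : VariableChange ℚ, C • W.quadraticTwist (NumberField.discr K : ℚ) = Wd)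
    (hrd : Wd.analyticRank ≤ 1)
    (hV : ∃ C : VariableChange K, C • W.baseChange K = V) (hshaK : V.ShaFinite)
    (hWR : (V.shaOrder : ℝ) * V.regulator * V.bsdPeriod * (V.modifiedTamagawaProduct : ℝ) /
        (V.torsionOrder : ℝ) ^ 2 = W.bsdRHS * Wd.bsdRHS)
    (hd : BSDp Wd p) : MissingPPartOverCAt V p ↔ BSDp W p := by
  refine ⟨fun hK => bsdp_of_pPartOverC_of_bsdp_twist W p K Wd V hGZK hmod hr h2 hWd hrd hV hshaK
    hWR hK hd, fun hW => ?_⟩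
  obtain ⟨-, hfinW⟩ := hGZK W hr
  obtain ⟨-, hfinD⟩ := hGZK Wd hrd
  haveI : Finite W.sha := hfinW
  haveI : Finite Wd.sha := hfinD
  obtain ⟨q, hq, hv⟩ := missingPPartAt_of_bsdp W p hW
  obtain ⟨qd, hqd, -⟩ := missingPPartAt_of_bsdp Wd p hd
  have hq' := exists_shaAnOverC_eq_of_rat W K Wd V hmod h2 hWd hV hfinW hfinD hWR hq hqd
  refine ⟨_, hq', ?_⟩
  have hdef := padicValRat_defectC_eq W p K Wd V hmod h2 hWd hV hfinW hfinD hshaK hWR hd hq hq'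
  linarith

/-- Lower half on `V` ⟺ lower half over `ℚ` (given `hWR`, finiteness, `BSD(Wd,p)`; any `p`).
[folklore] -/
theorem missingLowerBoundAt_iff_overC (hmod : hasEntireLFunction_rat) (h2 : Module.finrank ℚ K = 2)
    (hWd : ∃ C : VariableChange ℚ, C • W.quadraticTwist (NumberField.discr K : ℚ) = Wd)
    (hV : ∃ C : VariableChange K, C • W.baseChange K = V)
    (hshaW : W.ShaFinite) (hshaD : Wd.ShaFinite) (hshaK : V.ShaFinite)
    (hWR : (V.shaOrder : ℝ) * V.regulator * V.bsdPeriod * (V.modifiedTamagawaProduct : ℝ) /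
        (V.torsionOrder : ℝ) ^ 2 = W.bsdRHS * Wd.bsdRHS)
    (hd : BSDp Wd p) : MissingLowerBoundAt W p ↔ MissingLowerBoundOverCAt V p := by
  haveI : Finite Wd.sha := hshaD
  obtain ⟨qd, hqd, -⟩ := missingPPartAt_of_bsdp Wd p hd
  constructor
  · rintro ⟨q, hq, hle⟩
    have hq' := exists_shaAnOverC_eq_of_rat W K Wd V hmod h2 hWd hV hshaW hshaD hWR hq hqd
    refine ⟨_, hq', ?_⟩
    have := padicValRat_defectC_eq W p K Wd V hmod h2 hWd hV hshaW hshaD hshaK hWR hd hq hq'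
    linarith
  · rintro ⟨q', hq', hle⟩
    have hq := exists_shaAn_eq_of_overC W K Wd V hmod h2 hWd hV hshaW hshaD hshaK hWR hq' hqd
    refine ⟨_, hq, ?_⟩
    have := padicValRat_defectC_eq W p K Wd V hmod h2 hWd hV hshaW hshaD hshaK hWR hd hq hq'
    linarith

/-- Upper half on `V` ⟺ upper half over `ℚ` (given `hWR`, finiteness, `BSD(Wd,p)`; any `p`).
[folklore] -/
theorem missingUpperBoundAt_iff_overC (hmod : hasEntireLFunction_rat) (h2 : Module.finrank ℚ K = 2)
    (hWd : ∃ C : VariableChange ℚ, C • W.quadraticTwist (NumberField.discr K : ℚ) = Wd)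
    (hV : ∃ C : VariableChange K, C • W.baseChange K = V)
    (hshaW : W.ShaFinite) (hshaD : Wd.ShaFinite) (hshaK : V.ShaFinite)
    (hWR : (V.shaOrder : ℝ) * V.regulator * V.bsdPeriod * (V.modifiedTamagawaProduct : ℝ) /
        (V.torsionOrder : ℝ) ^ 2 = W.bsdRHS * Wd.bsdRHS)
    (hd : BSDp Wd p) : MissingUpperBoundAt W p ↔ MissingUpperBoundOverCAt V p := by
  haveI : Finite Wd.sha := hshaD
  obtain ⟨qd, hqd, -⟩ := missingPPartAt_of_bsdp Wd p hd
  constructor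
  · rintro ⟨q, hq, hle⟩
    have hq' := exists_shaAnOverC_eq_of_rat W K Wd V hmod h2 hWd hV hshaW hshaD hWR hq hqd
    refine ⟨_, hq', ?_⟩
    have := padicValRat_defectC_eq W p K Wd V hmod h2 hWd hV hshaW hshaD hshaK hWR hd hq hq'
    linarith
  · rintro ⟨q', hq', hle⟩
    have hq := exists_shaAn_eq_of_overC W K Wd V hmod h2 hWd hV hshaW hshaD hshaK hWR hq' hqd
    refine ⟨_, hq, ?_⟩
    have := padicValRat_defectC_eq W p K Wd V hmod h2 hWd hV hshaW hshaD hshaK hWR hd hq hq'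
    linarith

end Descent

end Summit.BirchSwinnertonDyer.Rank1Residual.AdditivePotMult

end
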